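import Mathlib.GroupTheory.Abelianization.Defs
import Mathlib.Topology.Algebra.Group.Basic
import Mathlib.Topology.Algebra.ContinuousMonoidHom
import Mathlib.RingTheory.Norm.Defs
import Mathlib.FieldTheory.AbsoluteGaloisGroup
import Mathlib.FieldTheory.Galois.Basic
import Mathlib.FieldTheory.Galois.Abelian
import Mathlib.RingTheory.Valuation.Discrete.Basic
import Mathlib.RingTheory.Valuation.ValuationSubring
import Mathlib.Analysis.Complex.Basic
import Literature.NumberTheory.GaloisRepresentations.LocalField
import Literature.NumberTheory.GaloisRepresentations.AbsGaloisGroup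
import Literature.NumberTheory.GaloisRepresentations.LocalGaloisGroup
import Literature.NumberTheory.GaloisRepresentations.WeilGroup
import HarnessLib

-- provenance: harness21/H21/H21/Prelude/GalRep/LocalClassFieldTheory.lean @ c2961f6 (interim HEAD d8f2665); M5 mechanical rewrite
/-!
# Local class field theory (trunk GalRep, item C18; notion `local_class_field_theory`)

Let `F` be a non-archimedean local field (`[IsNonarchimedeanLocalField F]`, Mathlib) with Weil
group `W_F = Literature.WeilGroup F` (item C7).  Local class field theory (Serre, *Local Fields*,
Ch. XIII–XIV; Serre, *Local class field theory*, in Cassels–Fröhlich (1967), Ch. VI; Tate,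
*Number theoretic background*, Corvallis 1979, §1) provides the *local Artin (reciprocity)
map*: a topological isomorphism `Fˣ ≃ W_F^ab` sending uniformisers to Frobenius lifts and the
units `𝒪_Fˣ` onto the image of inertia; composed with `Γ_F ↠ Γ_F^ab` its inverse identifies
`W_F^ab` with a dense subgroup of `Γ_F^ab = Field.absoluteGaloisGroupAbelianization F`
(Mathlib anchor, `Mathlib/FieldTheory/AbsoluteGaloisGroup.lean:59`), the profinite completion
of `Fˣ`.

## Contents

* `Literature.LocalArtinData F`: a *hypothesis structure* bundling a local Artin map, in the direction
  `artin : W_F →* Fˣ` (the inverse of the reciprocity map on `W_F^ab`, composed with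
  `W_F ↠ W_F^ab`), together with the properties consumed by the statements: open quotient map
  (hence continuous and surjective), kernel `= closure [W_F, W_F]`,
  `artin(I_F) = 𝒪_Fˣ = (valuation F).valuationSubring.unitGroup`, and the normalisation
  "geometric Frobenius ↦ uniformiser" (`(valuation F).IsUniformizer`, the trunk convention of
  `Literature.Prelude.GalRep.LocalField`).
* `Literature.IsLocalArtinMap F artin` (added 2026-08-16, statement re-type of the summit
  `Langlands`): the CHARACTERISING CLAUSES of the local Artin map as a `Prop` — the four clauses
  of `LocalArtinData` plus the RECIPROCITY LAW AT FINITE LEVEL `artin_mem_range_norm_iff`: for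
  every finite abelian extension `E/F` inside `F̄`, `artin w ∈ N_{E/F}(Eˣ) ↔ w|_E = 1` (Milne,
  *Class Field Theory*, Ch. I Thm. 1.1 (b): `φ_F` induces `Fˣ/N_{E/F}Eˣ ≅ Gal(E/F)`; Serre,
  *Local Fields* XIII §4 Thm. 2). With this clause the specification is CATEGORICAL in print
  (Milne I Thm. 1.1: "there is a unique homomorphism … (a) … (b) …"; uniqueness: `Fˣ` is
  generated by uniformisers, and for a uniformiser `ϖ` the Lubin–Tate tower `F_ϖ` is abelian
  with `ϖ ∈ N(F_{ϖ,n}ˣ)` and `F_ϖ · F^nr = F^ab`), recorded as the named fact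
  `IsLocalArtinMap.unique F`; existence (incl. (b)) is the named fact `exists_isLocalArtinMap F`.
  WHY a fifth clause: the four clauses of `LocalArtinData` are stable under `artin ↦ α ∘ artin`
  for every bicontinuous automorphism `α` of `Fˣ` preserving `𝒪_Fˣ` and uniformisers (e.g.
  `x ↦ ϖ^{2v(x)} x⁻¹`), so they do not determine `artin` on the units.
* `Literature.canonicalArtin F : W_F →* Fˣ` — **THE local Artin map, PINNED by specification**:
  Hilbert's `ε` over `IsLocalArtinMap F` (as `fontainePst` in
  `Literature/NumberTheory/PAdicHodge/FontaineDpst`); `isLocalArtinMap_canonicalArtin` (it has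
  the clauses, under existence), `canonicalArtin_eq` (it IS every map with the clauses, under
  uniqueness — so the `ε` is inessential). `LocalArtinData.IsCanonical d :⇔ d.artin =
  canonicalArtin F`, with `IsCanonical.artin_eq`: two canonical data have the same Artin map.
* WHERE THE PIN IS CONSUMED — design ("Variant R", 2026-08-16): the pin is NOT a field of
  `LocalArtinData` (nor of `LocalLanglandsDatum`): those TYPES keep admitting non-canonically
  normalised inhabitants, and their large discharged development (`nonempty_localArtinData_holds`,
  `exists_isCompatible_holds`, `LocalReciprocity*`, `LocalReciprocityNormFunctoriality*`) is left
  byte-for-byte intact. The pin is imposed where it matters — on the data the summit `Langlands`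
  quantifies over: `Summit.Langlands.ReciprocityData K` carries the field
  `llc_isCanonical : ∀ v, ((llc v).artin).IsCanonical`, so `∀ 𝓡 : ReciprocityData K` ranges only
  over local Langlands data normalised against THE Artin map of each `K_v` (Henniart-normalised),
  and no legal-but-non-canonical Artin normalisation can be packaged into a reciprocity datum on
  which the correspondence fails (which, under `∀ 𝓡`, would refute the summit by a typing artefact).
* `LocalArtinData.recGL1`: the induced map `(Fˣ →ₜ* ℂˣ) → (W_F →ₜ* ℂˣ)` (local Langlands for
  `GL₁`, bundled `ContinuousMonoidHom` on both sides) and `recGL1_bijective`.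
* `LocalArtinData.IsCompatible`: norm functoriality for a finite extension `E/F`.
* Named facts (`def … : Prop`, all in print; their proofs live in downstream `…Proofs` files,
  which import this one): `nonempty_localArtinData` (existence of the local
  Artin map — the text of lang.S08, restated with its id in the statements file),
  `exists_isCompatible` (norm functoriality, Serre LF XIII §4 Prop. 10 / Cassels–Fröhlich VI
  §2.4), `exists_intermediateField_normSubgroup_eq` (the existence theorem, Serre LF XIV §6:
  every open finite-index subgroup of `Fˣ` is the norm group of a finite abelian extension,
  phrased with Mathlib's `IsAbelianGalois`; its local-field binders are explicit since the
  2026-08-15 correction recorded in its docstring).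

## Sign convention (cross-reference `Literature.NumberTheory.GaloisRepresentations.WeilGroup`, module docstring)

We use Deligne's normalisation (Deligne, *Les constantes des équations fonctionnelles* (1973),
§2.3; Tate, Corvallis 1979, (1.4.1)): `artin` sends a *geometric* Frobenius — an element `w`
with `WeilGroup.deg w = -1` (recall `deg (arithmetic Frobenius) = +1`) — to a *uniformiser*, and
hence `|artin w|_F = ‖w‖ = q ^ deg w` (`WeilGroup.norm`).

## Mathlib search

Mathlib (this pin) has `Field.absoluteGaloisGroupAbelianization`, `Abelianization`,
`commutator`, `ContinuousMonoidHom` (`→ₜ*`), `IsOpenQuotientMap`, `Algebra.norm`,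
`IntermediateField`, `IsAbelianGalois` (`Mathlib/FieldTheory/Galois/Abelian.lean`),
`Valuation.IsUniformizer` (`Mathlib/RingTheory/Valuation/Discrete/Basic.lean`),
`ValuationSubring.unitGroup` (`Mathlib/RingTheory/Valuation/ValuationSubring.lean`), all of
which we use, but no local (or global) class field theory: `rg -i artin` only hits
Artin–Schreier-free files / `IsArtinian`, `rg -i reciprocity` only quadratic/Jacobi
reciprocity.  Nothing here duplicates a Mathlib declaration.

## Design choices

* `LocalArtinData` is a hypothesis structure (outline §4.6, D5), not a definition of the Artin
  map: constructing it requires the whole of local class field theory.  Existence is the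
  theorem `nonempty_localArtinData`.
* The map goes `W_F → Fˣ` rather than `Fˣ → W_F^ab` so that no quotient topology on
  `Abelianization (WeilGroup F)` is needed; `ker_artin` + `isOpenQuotientMap_artin` say exactly
  that `artin` induces `W_F^ab ≃ₜ* Fˣ`.  Continuity is not a separate field
  (`IsOpenQuotientMap.continuous`); it is provided as the lemma `continuous_artin`.
* `image_inertia` is an equality of bundled subgroups of `Fˣ`
  (`Subgroup.map` vs `ValuationSubring.unitGroup`), and `artin_frob` uses
  `(valuation F).IsUniformizer` (equivalent to "generates `𝓂[F]`" by
  `isUniformizer_of_maximalIdeal_eq_span` / `IsUniformizer.maximalIdeal_eq_span` in Mathlib).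
* `IsCompatible` takes the inclusion `res(W_E) ≤ W_F` as an explicit hypothesis `h` (as does
  `WeilGroup.map`), and both `E` and `F` carry their own local-field instances; the compatibility
  equation is stated in `Fˣ` via `Units.map ↑(Algebra.norm F)` ("on units").
  `exists_isCompatible` assumes `[ValuativeExtension F E]`, as does
  `WeilGroup.weilSubgroup_map_absGaloisRestrict_le` which supplies `h`.
* NOT stated: uniqueness of the Artin map characterised by norm-compatibility over *all* finite
  `E ⊆ F̄` (Serre LF XIII §4, Thm. 2′): `E : IntermediateField F (AlgebraicClosure F)` carries
  no `ValuativeRel`/`IsNonarchimedeanLocalField` instance in Mathlib and supplying one would put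
  `sorry` into data.  Accordingly there is no `∃!` in this file (outline review 8).
  Since 2026-08-16 uniqueness IS characterised — by the finite-level reciprocity clause of
  `IsLocalArtinMap` (Milne I Thm. 1.1 (b), which needs only `Algebra.norm`, `IsAbelianGalois`,
  `IntermediateField.fixingSubgroup`) — but as a SEPARATE `Prop` specification with the named
  fact `IsLocalArtinMap.unique`, not as a field of `LocalArtinData` (see "WHERE THE PIN IS
  CONSUMED" above).
* Sign convention of the pin: UNCHANGED, Deligne's (geometric Frobenius ↦ uniformiser) — the
  convention of every consumer: `WeilDeligneRep.ofQuasiChar` / `IsLocalLanglandsGL.gl_one`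
  (`rec₁(χ ∘ det) = χ ∘ artin`), the summit's Satake clause `arithFrobPolyOfSatake ι q 1 α`
  (roots `ι⁻¹(α_j⁻¹)` at an ARITHMETIC Frobenius, i.e. geometric-Frobenius eigenvalues
  `ι⁻¹(α_j) = ι⁻¹(χ_j(ϖ))`, Buzzard–Gee Rem. 3.2.5), and the Weil–Deligne recipes
  `IsWeilDeligneOfLadic` / (F8) of `FontaineDpst` (restriction to `W_F`, convention-neutral).
  Serre's `θ_F` (uniformiser ↦ ARITHMETIC Frobenius, `IsLocalReciprocityMap`) is converted by
  `artin w = (θ_F⁻¹[w])⁻¹` (Tate (1.4.1)) in `LocalClassFieldTheoryProofs.lean`.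
-/

noncomputable section

open ValuativeRel Field

namespace Literature.NumberTheory.GaloisRepresentations


/-! ### The local Artin map as a hypothesis structure -/

/-- A *local Artin datum* for a non-archimedean local field `F`: a homomorphism
`artin : W_F →* Fˣ` which is a continuous open quotient map with kernel the closure of the
commutator subgroup (so it induces a topological isomorphism `W_F^ab ≃ Fˣ`), maps the inertia
group `I_F` onto the units `𝒪_Fˣ`, and sends every geometric Frobenius (`deg w = -1`) to a
uniformiser (Deligne's normalisation).  Its inverse `Fˣ ≃ W_F^ab ↪ Γ_F^ab` is the local
reciprocity map, with dense image in `Field.absoluteGaloisGroupAbelianization F`.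
Ref: Serre, *Local Fields* (1979), Ch. XIII §4; Tate, *Number theoretic background* (Corvallis
1979), (1.4.1)–(1.4.6); Deligne, *Les constantes des équations fonctionnelles* (1973), §2.3.
[folklore] -/
structure LocalArtinData (F : Type*) [Field F] [ValuativeRel F] [TopologicalSpace F]
    [IsNonarchimedeanLocalField F] where
  /-- The local Artin map `W_F →* Fˣ` (inverse reciprocity map composed with `W_F → W_F^ab`). -/
  artin : WeilGroup F →* Fˣ
  /-- `artin` is an open quotient map for the Weil topology on `W_F` and the unit topology on
  `Fˣ` (in particular continuous and surjective). -/
  isOpenQuotientMap_artin : IsOpenQuotientMap artin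
  /-- The kernel of `artin` is the closure of the commutator subgroup `[W_F, W_F]`. -/
  ker_artin :
    (artin.ker : Set (WeilGroup F)) = closure (commutator (WeilGroup F) : Set (WeilGroup F))
  /-- `artin` maps the inertia group `I_F` onto the unit group `𝒪_Fˣ ≤ Fˣ`
  (`ValuationSubring.unitGroup`, membership `v u = 1`). -/
  image_inertia : (WeilGroup.inertia F).map artin = (valuation F).valuationSubring.unitGroup
  /-- Deligne's normalisation: a geometric Frobenius (`deg w = -1`) is sent to a uniformiser
  of `F` (`Valuation.IsUniformizer`, the trunk convention of `Literature.Prelude.GalRep.LocalField`). -/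
  artin_frob : ∀ w : WeilGroup F, WeilGroup.deg w = -1 →
    (valuation F).IsUniformizer (artin w : F)

/-- **Local class field theory, existence of the Artin map.**  For every non-archimedean local
field `F` there is a local Artin datum: a topological isomorphism `Fˣ ≅ W_F^ab` sending
uniformisers to (geometric) Frobenius lifts and `𝒪_Fˣ` onto the image of inertia.  This is the
text of statement lang.S08 (restated with its id in `H21/Statements/Lang/LocalGalois.lean`).
Ref: Serre, *Local Fields* (1979), Ch. XIII §4, Thm. 1–2 and Cor.; Tate, *Number theoretic
background* (Corvallis 1979), (1.4.1)–(1.4.6). [cite: Corvallis1979] -/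
def nonempty_localArtinData : Prop :=
  ∀ (F : Type*) [Field F] [ValuativeRel F] [TopologicalSpace F] [IsNonarchimedeanLocalField F],
    Nonempty (LocalArtinData F)

/-! ### The characterising clauses and the pinned Artin map (2026-08-16; additions only) -/

section Pin

variable (F : Type*) [Field F] [ValuativeRel F] [TopologicalSpace F] [IsNonarchimedeanLocalField F]

/-- **The characterising clauses of the local Artin map** `artin : W_F →* Fˣ` (Deligne's
normalisation): `artin` is an open quotient map with kernel `closure [W_F, W_F]`, maps `I_F` onto
`𝒪_Fˣ`, sends geometric Frobenius elements (`deg w = -1`) to uniformisers, and satisfies the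
RECIPROCITY LAW AT FINITE LEVEL: for every finite abelian extension `E/F` inside `F̄`,
`artin w ∈ N_{E/F}(Eˣ) ↔ w|_E = 1` (Milne, *Class Field Theory*, Ch. I, Thm. 1.1 (a)–(b): the
properties that determine the local Artin map uniquely; Serre, *Local Fields*, XIII §4 Thm. 1–2,
Prop. 13, XIV §6). Every clause is a theorem of the literature for the genuine map
`w ↦ (θ_F⁻¹[w])⁻¹` (Tate (1.4.1)); the last one by norm functoriality `Art_F ∘ res = N_{E/F} ∘ Art_E`
(Serre XIII §4 Prop. 10) and `Art_E : W_E ↠ Eˣ`, `ker Art_F = closure [W_F, W_F] ≤ Γ_E ∩ W_F`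
for `E/F` abelian. The first four clauses are those of `LocalArtinData` verbatim
(`LocalArtinData.isLocalArtinMap_iff`). [cite: SerreLocalFields1979, Ch. XIII §4 Thm. 1–2 and Prop. 13]
[cite: Corvallis1979, (1.4.1)–(1.4.6)] -/
structure IsLocalArtinMap (artin : WeilGroup F →* Fˣ) : Prop where
  /-- `artin` is an open quotient map (in particular continuous and surjective). -/
  isOpenQuotientMap_artin : IsOpenQuotientMap artin
  /-- The kernel of `artin` is the closure of the commutator subgroup `[W_F, W_F]`. -/
  ker_artin :
    (artin.ker : Set (WeilGroup F)) = closure (commutator (WeilGroup F) : Set (WeilGroup F))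
  /-- `artin` maps the inertia group `I_F` onto `𝒪_Fˣ`. -/
  image_inertia : (WeilGroup.inertia F).map artin = (valuation F).valuationSubring.unitGroup
  /-- Deligne's normalisation: geometric Frobenius elements go to uniformisers. -/
  artin_frob : ∀ w : WeilGroup F, WeilGroup.deg w = -1 → (valuation F).IsUniformizer (artin w : F)
  /-- Reciprocity law at finite level (Milne I Thm. 1.1 (b); Serre XIII §4 Thm. 2): for a finite
  abelian `E/F` inside `F̄`, `artin w` is a norm from `E` iff `w` fixes `E` pointwise. -/
  artin_mem_range_norm_iff : ∀ (E : IntermediateField F (AlgebraicClosure F))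
    [FiniteDimensional F E] [IsAbelianGalois F E] (w : WeilGroup F),
    artin w ∈ (Units.map (Algebra.norm F : E →* F)).range ↔
      WeilGroup.toAbsGalois F w ∈ E.fixingSubgroup

/-- **THE local Artin map of `F`, pinned by specification**: Hilbert's `ε` over the characterising
clauses `IsLocalArtinMap F` (the type `W_F →* Fˣ` is inhabited by the trivial homomorphism,
which only serves `Nonempty`). Under the named fact `exists_isLocalArtinMap F` it satisfies every
clause (`isLocalArtinMap_canonicalArtin`); under `IsLocalArtinMap.unique F` it IS every Artin map
with the clauses (`canonicalArtin_eq`). Nothing else about it is provable: a statement about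
`canonicalArtin F` holds exactly when it holds for EVERY homomorphism with the clauses (which, in
print, is one homomorphism: Milne I Thm. 1.1). Upgrade path: when the Artin map is CONSTRUCTED in
the tree with all five clauses (from `LocalReciprocity`/Lubin–Tate), replace this body by the
construction, same name and type. Consumed by `Summit.Langlands.ReciprocityData.llc_isCanonical`.
[cite: SerreLocalFields1979, Ch. XIII §4 Thm. 1–2] -/
def canonicalArtin : WeilGroup F →* Fˣ :=
  Classical.epsilon (IsLocalArtinMap F)

/-- **Existence of the local Artin map with its characterising clauses** (named fact, D-0014;
T0 for the summit `Langlands`): some `artin : W_F →* Fˣ` satisfies `IsLocalArtinMap F` — Milne,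
*Class Field Theory* I Thm. 1.1 (existence), restricted along `W_F ↪ Γ_F`; Serre, *Local Fields*
XIII §4 Thm. 1–2, XIV §6 Remark 2. The four `LocalArtinData` clauses are discharged in the tree
(`nonempty_localArtinData_holds`); the finite-level clause `artin_mem_range_norm_iff` for that
map is the remaining build debt of this fact. [cite: SerreLocalFields1979, Ch. XIII §4 Thm. 2] -/
def exists_isLocalArtinMap : Prop :=
  ∃ artin : WeilGroup F →* Fˣ, IsLocalArtinMap F artin

/-- **Uniqueness of the local Artin map of `F`** (named fact, D-0014): two homomorphisms
`W_F →* Fˣ` with the characterising clauses are equal — Milne, *Class Field Theory* I Thm. 1.1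
("there is a unique homomorphism … (a) … (b) …"): `Fˣ` is generated by uniformisers, and for
a uniformiser `ϖ` the Lubin–Tate extensions `F_{ϖ,n}` are abelian with `ϖ ∈ N(F_{ϖ,n}ˣ)` and
`⋃ₙ F_{ϖ,n} · F^nr = F^ab` (local Kronecker–Weber), so (a) and (b) determine the image of `ϖ`.
Its in-tree proof from the `LubinTate*` files is build debt; under it the pin `canonicalArtin F`
is THE Artin map (`canonicalArtin_eq`). [cite: SerreLocalFields1979, Ch. XIII §4 Thm. 1–2] -/
def IsLocalArtinMap.unique : Prop :=
  ∀ a a' : WeilGroup F →* Fˣ, IsLocalArtinMap F a → IsLocalArtinMap F a' → a = a'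

variable {F} in
/-- Under existence, the pinned map satisfies every clause (`Classical.epsilon_spec`). [folklore] -/
theorem isLocalArtinMap_canonicalArtin (h : exists_isLocalArtinMap F) :
    IsLocalArtinMap F (canonicalArtin F) :=
  Classical.epsilon_spec h

variable {F} in
/-- Under uniqueness, the pinned map IS any Artin map with the clauses (so the `ε` is
inessential). [folklore] -/
theorem canonicalArtin_eq (hu : IsLocalArtinMap.unique F) {a : WeilGroup F →* Fˣ}
    (ha : IsLocalArtinMap F a) : canonicalArtin F = a :=
  hu _ _ (Classical.epsilon_spec ⟨a, ha⟩) ha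

end Pin

namespace LocalArtinData

section Pin

variable {F : Type*} [Field F] [ValuativeRel F] [TopologicalSpace F]
  [IsNonarchimedeanLocalField F]

/-- **The datum is normalised against THE Artin map**: `d.artin = canonicalArtin F`. This is the
predicate the summit's `Summit.Langlands.ReciprocityData.llc_isCanonical` imposes at every
completion; `LocalArtinData` itself is left free (Variant R, see the module docstring). [folklore] -/
def IsCanonical (d : LocalArtinData F) : Prop :=
  d.artin = canonicalArtin F

/-- Two canonically normalised data have the SAME Artin map (hence the same `recGL1`). [folklore] -/
theorem IsCanonical.artin_eq {d d' : LocalArtinData F} (h : d.IsCanonical) (h' : d'.IsCanonical) :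
    d.artin = d'.artin :=
  h.trans h'.symm

/-- … and the same local Langlands for `GL₁`. [folklore] -/
theorem IsCanonical.recGL1_eq {d d' : LocalArtinData F} (h : d.IsCanonical) (h' : d'.IsCanonical)
    (χ : Fˣ →ₜ* ℂˣ) (w : WeilGroup F) : χ (d.artin w) = χ (d'.artin w) := by
  rw [h.artin_eq h']

/-- A datum's four fields are the first four clauses of the specification: `d.artin` meets
`IsLocalArtinMap` iff it also satisfies the finite-level reciprocity law. [folklore] -/
theorem isLocalArtinMap_iff (d : LocalArtinData F) : IsLocalArtinMap F d.artin ↔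
    ∀ (E : IntermediateField F (AlgebraicClosure F)) [FiniteDimensional F E] [IsAbelianGalois F E]
      (w : WeilGroup F), d.artin w ∈ (Units.map (Algebra.norm F : E →* F)).range ↔
        WeilGroup.toAbsGalois F w ∈ E.fixingSubgroup :=
  ⟨fun h E ↦ h.artin_mem_range_norm_iff E,
    fun h ↦ ⟨d.isOpenQuotientMap_artin, d.ker_artin, d.image_inertia, d.artin_frob, h⟩⟩

/-- A canonical datum exists as soon as some Artin map has the five clauses: package the pinned
map with the four clauses it then satisfies. [folklore] -/
def ofExistsIsLocalArtinMap (h : exists_isLocalArtinMap F) : LocalArtinData F where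
  artin := canonicalArtin F
  isOpenQuotientMap_artin := (isLocalArtinMap_canonicalArtin h).isOpenQuotientMap_artin
  ker_artin := (isLocalArtinMap_canonicalArtin h).ker_artin
  image_inertia := (isLocalArtinMap_canonicalArtin h).image_inertia
  artin_frob := (isLocalArtinMap_canonicalArtin h).artin_frob

/-- `ofExistsIsLocalArtinMap h` is canonically normalised (by `rfl`). [folklore] -/
theorem isCanonical_ofExistsIsLocalArtinMap (h : exists_isLocalArtinMap F) :
    (ofExistsIsLocalArtinMap h).IsCanonical :=
  rfl

/-- Under uniqueness, EVERY datum whose Artin map also satisfies the finite-level reciprocity law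
is canonical. [folklore] -/
theorem isCanonical_of_unique (hu : IsLocalArtinMap.unique F) {d : LocalArtinData F}
    (hd : IsLocalArtinMap F d.artin) : d.IsCanonical :=
  (canonicalArtin_eq hu hd).symm

end Pin

section GL1

variable {F : Type*} [Field F] [ValuativeRel F] [TopologicalSpace F]
  [IsNonarchimedeanLocalField F]

/-- `artin` is surjective (it is a quotient map).
Ref: Serre, *Local Fields* (1979), Ch. XIII §4, Thm. 1. [folklore] -/
theorem artin_surjective (d : LocalArtinData F) : Function.Surjective d.artin :=
  d.isOpenQuotientMap_artin.surjective

/-- `artin` is continuous (it is an open quotient map).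
Ref: Serre, *Local Fields* (1979), Ch. XIII §4, Thm. 1. [folklore] -/
theorem continuous_artin (d : LocalArtinData F) : Continuous d.artin :=
  d.isOpenQuotientMap_artin.continuous

/-- The local Artin map as a bundled continuous homomorphism `W_F →ₜ* Fˣ`.
Ref: Serre, *Local Fields* (1979), Ch. XIII §4, Thm. 1. [folklore] -/
def artinContinuousMonoidHom (d : LocalArtinData F) : WeilGroup F →ₜ* Fˣ where
  toMonoidHom := d.artin
  continuous_toFun := d.continuous_artin

/-- Unfolding lemma for `artinContinuousMonoidHom`.  Ref: Serre, *Local Fields*, XIII §4.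
[folklore] -/
@[simp]
theorem artinContinuousMonoidHom_apply (d : LocalArtinData F) (w : WeilGroup F) :
    d.artinContinuousMonoidHom w = d.artin w :=
  rfl

/-- The local Langlands correspondence for `GL₁`: a continuous quasi-character `χ : Fˣ →ₜ* ℂˣ`
is sent to the continuous character `χ ∘ artin : W_F →ₜ* ℂˣ` of the Weil group.
Ref: Tate, *Number theoretic background* (Corvallis 1979), (1.4.5), (2.1); Langlands, *Problems
in the theory of automorphic forms* (1970), §2. [cite: Corvallis1979] -/
def recGL1 (d : LocalArtinData F) (χ : Fˣ →ₜ* ℂˣ) : WeilGroup F →ₜ* ℂˣ :=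
  χ.comp d.artinContinuousMonoidHom

/-- Unfolding lemma for `recGL1`.  Ref: Tate, Corvallis 1979, (1.4.5).
[cite: Corvallis1979, (1.4.5)] -/
@[simp]
theorem recGL1_apply (d : LocalArtinData F) (χ : Fˣ →ₜ* ℂˣ) (w : WeilGroup F) :
    d.recGL1 χ w = χ (d.artin w) :=
  rfl

/-- `recGL1` is injective (`artin` is surjective).
Ref: Tate, *Number theoretic background* (Corvallis 1979), (1.4.5). [cite: Corvallis1979] -/
theorem recGL1_injective (d : LocalArtinData F) : Function.Injective d.recGL1 := by
  intro χ χ' h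
  refine ContinuousMonoidHom.ext fun u => ?_
  obtain ⟨w, rfl⟩ := d.artin_surjective u
  simpa using congr($h w)

/-- Local Langlands for `GL₁`: `χ ↦ χ ∘ artin` is a bijection between continuous
quasi-characters of `Fˣ` and continuous characters `W_F →ₜ* ℂˣ` (every continuous character of
`W_F` into the abelian group `ℂˣ` kills `closure [W_F, W_F] = ker artin`, and `artin` is an open
quotient map).
Ref: Tate, *Number theoretic background* (Corvallis 1979), (1.4.5), (2.1). [cite: Corvallis1979] -/
def recGL1_bijective : Prop :=
  ∀ (d : LocalArtinData F),
    Function.Bijective d.recGL1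

end GL1

/-! ### Functoriality (norm compatibility) -/

section Compatible

variable {F E : Type*} [Field F] [ValuativeRel F] [TopologicalSpace F]
  [IsNonarchimedeanLocalField F] [Field E] [ValuativeRel E] [TopologicalSpace E]
  [IsNonarchimedeanLocalField E] [Algebra F E]

/-- Norm compatibility of local Artin data along an extension `E/F` of non-archimedean local
fields: the square with `WeilGroup.map : W_E → W_F` (induced by restriction `Γ_E → Γ_F`, under
the explicit inclusion hypothesis `h`) and the norm on units
`Units.map N_{E/F} : Eˣ →* Fˣ` commutes, `artin_F (map w) = N_{E/F} (artin_E w)` in `Fˣ`.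
Ref: Serre, *Local Fields* (1979), Ch. XIII §4, Prop. 10; Serre, *Local class field theory*
(Cassels–Fröhlich, Ch. VI), §2.4. [folklore] -/
def IsCompatible (dF : LocalArtinData F) (dE : LocalArtinData E)
    (h : (weilSubgroup E).map (absGaloisRestrict F E).toMonoidHom ≤ weilSubgroup F) : Prop :=
  ∀ w : WeilGroup E,
    dF.artin (WeilGroup.map F E h w) = Units.map (Algebra.norm F : E →* F) (dE.artin w)

/-- `IsCompatible` after coercion to `F`: `↑(artin_F (map w)) = N_{E/F} ↑(artin_E w)`.
Ref: Serre, *Local Fields* (1979), Ch. XIII §4, Prop. 10. [folklore] -/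
theorem isCompatible_iff (dF : LocalArtinData F) (dE : LocalArtinData E)
    (h : (weilSubgroup E).map (absGaloisRestrict F E).toMonoidHom ≤ weilSubgroup F) :
    dF.IsCompatible dE h ↔ ∀ w : WeilGroup E,
      (dF.artin (WeilGroup.map F E h w) : F) = Algebra.norm F (dE.artin w : E) := by
  simp only [IsCompatible, Units.ext_iff, Units.coe_map]

end Compatible

end LocalArtinData

/-! ### Functoriality and the existence theorem -/

section Theorems

variable (F : Type*) [Field F] [ValuativeRel F] [TopologicalSpace F]
  [IsNonarchimedeanLocalField F]

/-- **Norm functoriality of the local Artin map.**  For a finite extension `E/F` of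
non-archimedean local fields (the valuation of `E` extending that of `F`) such that restriction
maps `W_E` into `W_F` (hypothesis `h`, supplied by
`WeilGroup.weilSubgroup_map_absGaloisRestrict_le`), there are local Artin data for `F` and `E`
compatible with the norm: `artin_F ∘ res = N_{E/F} ∘ artin_E`.  (Since uniqueness of the Artin
map is not part of `LocalArtinData`, this is the existence half of the cited proposition.)
Ref: Serre, *Local Fields* (1979), Ch. XIII §4, Prop. 10; Serre, *Local class field theory*
(Cassels–Fröhlich, Ch. VI), §2.4. [cite: SerreLocalFields1979, Ch. XIII §4 Prop. 10] -/
def exists_isCompatible : Prop :=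
  ∀ (E : Type*) [Field E] [ValuativeRel E] [TopologicalSpace E] [IsNonarchimedeanLocalField E]
    [Algebra F E] [FiniteDimensional F E] [ValuativeExtension F E]
    (h : (weilSubgroup E).map (absGaloisRestrict F E).toMonoidHom ≤ weilSubgroup F),
    ∃ (dF : LocalArtinData F) (dE : LocalArtinData E), dF.IsCompatible dE h

end Theorems

/-- **Existence theorem of local class field theory.**  For a non-archimedean local field `F`,
every open subgroup of finite index `U ≤ Fˣ` is a norm group: there is a finite abelian Galois
extension `E/F` inside `F̄` (`IsAbelianGalois F E`) with `N_{E/F}(Eˣ) = U`.  Serre states it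
for `K` complete under a discrete valuation with finite residue field and for *closed*
subgroups of finite index (Thm. 1: "Every closed subgroup of finite index in `K*` is a norm
group"), noting (Cor. 1) that for subgroups of finite index closed ⟺ open ⟺ `⊇ U_K^{(n)}` for
some `n`; the uniqueness of `E` is not asserted here.
The local-field hypotheses `[ValuativeRel F] [IsNonarchimedeanLocalField F]` are *explicit*
binders of this def (correction of 2026-08-15, same name, same body): as first vendored they
were ambient section instances which, being unused in the body, Lean dropped, so that the
constant quantified over all topological fields — false in that generality, see
`not_forall_exists_intermediateField_normSubgroup_eq` (`LocalExistenceTheorem.lean`, `F = 𝔽₃`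
discrete, `U = ⊥`).  Every user applies the predicate to a local field, where nothing changed;
`localExistenceTheorem F` (`LocalExistenceTheorem.lean`) is the same statement
(`localExistenceTheorem_iff`, by `Iff.rfl`), obtained downstream from the finite-level
reciprocity law (`localExistenceTheorem_of_exists_isReciprocitySystem`,
`LocalCFTFromReciprocitySystem.lean`, with `LocalWeilDatum.exists_isReciprocitySystem_holds`).
Ref: Serre, *Local Fields* (1979), Ch. XIV §6, Thm. 1 and Cor. 1 (p. 218); Serre, *Local class
field theory* (Cassels–Fröhlich, Ch. VI), §2.6–2.7.
[cite: SerreLocalFields1979, Ch. XIV §6 Thm. 1] -/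
def exists_intermediateField_normSubgroup_eq (F : Type*) [Field F] [ValuativeRel F]
    [TopologicalSpace F] [IsNonarchimedeanLocalField F] : Prop :=
  ∀ (U : Subgroup Fˣ) (hU : IsOpen (U : Set Fˣ)) (hU' : U.FiniteIndex),
    ∃ E : IntermediateField F (AlgebraicClosure F), FiniteDimensional F E ∧ IsAbelianGalois F E ∧
      (Units.map (Algebra.norm F : E →* F)).range = U

end Literature.NumberTheory.GaloisRepresentations
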